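import Literature.MathematicalPhysics.QuantumFieldTheory.Balaban1983to89.B4Eq220CommutatorField

/-!
# [B4] (2.20)/(2.21) AT A REGULAR FIELD `Ã = A₀ + A′ ≠ 0` ON A BOX: THE FACTOR BOUND
# «‖K_{ω_i}G_k(□_{ω_i},Ã_{ω_i})h_{ω_i}‖_{q,p} ≤ c₂O(1)M⁻¹» of [Balaban1983RegularityDecay] FROM LEMMA 2.2 (2.17) AT `Ã`
# — sup norm (2.20), the printed parallelogram of exponents with the `η`-decay and in the `η`-weighted norms (2.21),
# staircase contours with the operator-side hypotheses discharged, and [B4]'s own partition function `h_j`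

statement-level skeleton of published theorems with citation tags; proofs where landed; nothing here is a claim about the Yang–Mills mass gap

CITATION HEADER.  T. Bałaban, *Regularity and decay of lattice Green's functions*, Commun. Math. Phys. **89** (1983)
571–597, doi:10.1007/bf01214744 [Balaban1983RegularityDecay] (cell paper B4; held text
`paper:balaban1983-cmp89-regularity-decay`, journal page = PDF page + 570; pp. 575–579).  Unit `lit-balaban-p35` gen 5,
HOME `run/shared/lean/pub/lit-balaban/`, SKELETON row **B4.Eq2.18** ((2.18)–(2.22)) — the factor bound (2.20)/(2.21)
AT A FIELD, the per-cube input `β` of `B4Ineq110WalkRoute`/`B4LpChain221` for the interior cubes («if □_j is an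
interior cube of Ω, then … Ã_j = A₀ + θ_jA′», p. 575).  Imports `B4Eq220CommutatorField` (the covariant commutator
`kOp` and the reduction `eq220_field_reduction_lp`/`_sup`) and, through it, the Lemma-2.2 lineage at `Ã`
(`B4Lemma22CrossSup.lemma22_17_sup_box`, `B4Lemma22SupStair.lemma22_17_sup_stair`,
`B4Lemma22EtaBox.lemma22_17_pq_box_eta`/`_psup_box_eta`/`_pq_stair_eta`, `lpW`) and r01's sizes of the concrete `h_j`
(`B4Eq220PartitionSizes.hsize_hBox`).

WHAT IS PRINTED (p. 578, verbatim).  «We estimate the first sum using Lemma 2.2 by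
(2.20) Σ′_{ω:n≤n₀}c₁‖K_{ω₁}G_k(□_{ω₁},Ã_{ω₁})h_{ω₁}‖_∞ · … · ‖K_{ω_n}G_k(□_{ω_n},Ã_{ω_n})h_{ω_n}‖_∞‖f‖_∞
≤ Σ′_{ω:n≤n₀}c₁(c₂O(1)M⁻¹)ⁿ‖f‖_∞.  We apply Lemma 2.2 to the terms of the second sum also, more exactly we apply (2.17)
with 1/p₁ = 1/(2n₀) and we fix n₀ such that p₁ = 2n₀ > d + 1, e.g. n₀ = d. We estimate the second sum by
(2.21) Σ′_{ω:n>n₀}c₁‖K_{ω₁}G_k(□_{ω₁},Ã_{ω₁})h_{ω₁}‖_{∞,p₁}Π_{i=2}^{n₀}‖K_{ω_i}G_k(□_{ω_i},Ã_{ω_i})h_{ω_i}‖_{p₁/(i−1),p₁/i}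
· Π_{i=n₀+1}^{n}‖K_{ω_i}G_k(□_{ω_i},Ã_{ω_i})h_{ω_i}‖_{2,2}‖f‖₂ ≤ Σ′_{ω:n>n₀}c₁(c₂O(1)M⁻¹)ⁿ‖f‖_∞.»; p. 579: «Here ‖T‖_{q,p}
denotes a norm of an operator T : L^p → L^q.»

WHAT THIS MODULE PROVES (all in full; `d + 1` lattice dimensions — the print's `d`; fine box `□ = Π_μ[0, L^kM_μ)`, mesh
`η = L^{-k}`, `L = ℓ + 1 ≥ 2`; window `a ∈ [amin, aplus]`, `amin > 0`, `m² ∈ [0, m2plus]`; `Ã = A₀ + A′` with `A₀`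
constant and `A′` antisymmetric, small and slowly varying as in the Lemma-2.2 lineage; `h` any function with the sizes
`HSize` (`|h| ≤ 1`, `|∂^ηh| ≤ δ₁`, `|Δ^{η,N}_□h| ≤ δ₂`, block oscillation `≤ δ₃`); the factor is
`Φ ↦ K_hG_k(□,Ã)(hΦ)` = `kOp ⋯ h *ᵥ (greenA ⋯ *ᵥ (mulH h *ᵥ Φ))`, `factor_mulVec`).
* §1 GENERAL CONTOUR SYSTEM (hypotheses exactly those of `B4Lemma22CrossSup.lemma22_17_sup_box` plus `A′_b̄ = −A′_b`):
  **`eq220_sup_box`** — (2.20): `‖K_hG(hΦ)‖_∞ ≤ (2(d+1)(1+ℓθ)δ₁ + δ₂ + a_kδ₃)·2(d+2)c·‖Φ‖_∞`;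
  **`eq221_pq_box`** — (2.21), all pairs `1 ≤ p ≤ q < ∞` with `1/p − 1/q ≤ 1/p₁`, `p₁ > d + 1`:
  `‖K_hG(hΦ)‖_q ≤ (2(d+1)(1+ℓθ)δ₁ + δ₂ + a_kδ₃)·2C·vol^{−(1/p−1/q)}·‖Φ‖_p` (counting-measure norms, `vol = η^{−(d+1)}`);
  **`eq221_psup_box`** — the first factor «‖·‖_{∞,p₁}»: `‖K_hG(hΦ)‖_∞ ≤ (…)·2C·vol^{−1/p}‖Φ‖_p`, `p ≥ p₁`.
* §2 STAIRCASE CONTOURS OF `B4Lower18Regular`, EVERY OPERATOR-SIDE HYPOTHESIS DISCHARGED but the printed smallness of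
  the field: **`eq220_sup_stair`**, **`eq221_pq_stair`**, and in the print's `η`-weighted norms `‖·‖_{p,η}`
  (`B4Lemma22EtaBox.lpW`) with an `η`-INDEPENDENT constant **`eq221_weighted_stair`**:
  `‖K_hG(hΦ)‖_{q,η} ≤ (2(d+1)(1+ℓθ)δ₁ + δ₂ + a_kδ₃)·2C·‖Φ‖_{p,η}`.
* §3 [B4]'s OWN PARTITION FUNCTION `h_j` (`B4Eq220PartitionSizes.hBox`, sizes `hsize_hBox`: `δ₁ = δ₃ = s/K`,
  `δ₂ = s/K²`, `s = (d+1)(D1(h) + D2(h))`, `K` = the print's large-cube size `M`, box sides multiples of `K`):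
  **`eq220_hBox_sup_stair`** — «‖K_jG_k(□_j,Ã_j)h_j‖_∞ ≤ c₂O(1)M⁻¹» with `c₂O(1) = (2(d+1)(1+ℓθ) + 1 + a_k)·s·2(d+2)c`;
  **`eq221_hBox_weighted_stair`** — the same for every factor «‖·‖_{p₁/(i−1),p₁/i}», «‖·‖_{2,2}» of (2.21) in the
  `η`-weighted norms, constant `(2(d+1)(1+ℓθ) + 1 + a_k)·s·2C`, independent of `η`.

HONEST SCOPE.  (i) Boxes only (Lemma 2.2 is stated for «a rectangular parallelepiped □»; the interior cubes `□_j` of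
p. 575 are such), with [B4]'s Neumann bond weights and block averaging at the running coefficient `a_k`; the boundary
cubes (Lemma 2.1, `Ã_j = A`) are not treated here.  (ii) The field hypotheses are the lineage's reading of «A′ is
regular and small» (bond size `θ/n`, bond derivative `θ′/n²`, `A′ = 0` on the bonds touching the faces — «changing
regularly to a constant function in a neighbourhood of a boundary of □_j» —, contour sums `τ`) with the two explicit
smallness conditions standing for «for e sufficiently small»; antisymmetry «A_b̄ = −A_b» (p. 576) is an explicit
hypothesis on `A′`.  (iii) Exponents: `q < ∞` pairs of the parallelogram through `lpM`/`lpW`, the edge `q = ∞`,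
`p ≥ p₁` and the corner `p = q = ∞` through `supN` (as in `B4Lemma22EtaBox`, HONEST SCOPE (3)).  (iv) Nothing of
(2.12)–(2.13), (2.18)–(2.19), (2.22) is summed here (`B4RandomWalk213`, `B4LpChain221`, `B4Ineq110WalkRoute`).
Theorems only; no `def`, no `Prop` fact, no `sorry`; axioms standard.
-/

namespace Literature.MathematicalPhysics.QuantumFieldTheory.Balaban1983to89.B4Eq220FactorField

open Finset Matrix
open Literature.MathematicalPhysics.QuantumFieldTheory.Balaban1983to89.B4GaugeCovariance
open Literature.MathematicalPhysics.QuantumFieldTheory.Balaban1983to89.B4Commutators25to211 (mulH)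
open Literature.MathematicalPhysics.QuantumFieldTheory.Balaban1983to89.B4Reflection242 (boxDom nbrs)
open Literature.MathematicalPhysics.QuantumFieldTheory.Balaban1983to89.B4Lower18Regular (e1 baseEmb stairContour lsum)
open Literature.MathematicalPhysics.QuantumFieldTheory.Balaban1983to89.B4Lemma22Reduce231 (supN supN_nonneg)
open Literature.MathematicalPhysics.QuantumFieldTheory.Balaban1983to89.B4Lemma22ReduceZero (Box opA greenA derivA
  derivA0)
open Literature.MathematicalPhysics.QuantumFieldTheory.Balaban1983to89.B4Lemma22LpStair (lpM lpM_nonneg)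
open Literature.MathematicalPhysics.QuantumFieldTheory.Balaban1983to89.B4Lemma22PertVSup (constBond_antisymm)
open Literature.MathematicalPhysics.QuantumFieldTheory.Balaban1983to89.B4Lemma22CrossSup (lemma22_17_sup_box)
open Literature.MathematicalPhysics.QuantumFieldTheory.Balaban1983to89.B4Lemma22SupStair (lemma22_17_sup_stair)
open Literature.MathematicalPhysics.QuantumFieldTheory.Balaban1983to89.B4Lemma22EtaBox (vol vol_pos lpW lpW_nonneg
  lpW_le_of_lpM supN_le_lpW_of lemma22_17_pq_box_eta lemma22_17_psup_box_eta lemma22_17_pq_stair_eta)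
open Literature.MathematicalPhysics.QuantumFieldTheory.Balaban1983to89.B4Eq220CommutatorZeroBox (HSize)
open Literature.MathematicalPhysics.QuantumFieldTheory.Balaban1983to89.B4PartitionUnity22 (hprof D1 D2 D1_nonneg
  D2_nonneg contDiff_hprof hasCompactSupport_hprof)
open Literature.MathematicalPhysics.QuantumFieldTheory.Balaban1983to89.B4Eq220PartitionSizes (hBox hsize_hBox)
open Literature.MathematicalPhysics.QuantumFieldTheory.Balaban1983to89.B4Eq220CommutatorField (kOp lpM_mulH_le
  supN_mulH_le eq220_field_reduction_lp eq220_field_reduction_sup sizes_Minv_field)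

noncomputable section

variable {ι : Type} [Fintype ι] [DecidableEq ι]

/-! ## §0. Plumbing: antisymmetry of `A₀ + A′`, positivity of `a_k`, the factor as an operator -/

/-- `Ã = A₀ + A′` is antisymmetric when `A′` is («A_b̄ = −A_b»; the constant part by
`B4Lemma22PertVSup.constBond_antisymm`). [folklore] -/
private theorem field_antisymm {d : ℕ} {X : Type*} (A₀ : Fin (d + 1) → ℝ) (pos : X → Fin (d + 1) → ℤ)
    {A' : X → X → ℝ} (hanti' : ∀ x y, A' y x = -A' x y) (x y : X) :
    (constBond A₀ pos + A') y x = -(constBond A₀ pos + A') x y := by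
  simp only [Pi.add_apply, constBond_antisymm A₀ pos x y, hanti' x y, neg_add]

/-- `a_k ≥ 0` on the window. [folklore] -/
private theorem aSeq_nonneg {ℓ k : ℕ} (hℓ : 1 ≤ ℓ) (hk : 1 ≤ k) {amin a : ℝ} (ha : 0 < amin) (e1' : amin ≤ a) :
    0 ≤ B1.aSeq a ((ℓ : ℝ) + 1) k := by
  have hL : (1 : ℝ) < (ℓ : ℝ) + 1 := by
    have : (1 : ℝ) ≤ (ℓ : ℝ) := by exact_mod_cast hℓ
    linarith
  exact (B1.aSeq_pos (lt_of_lt_of_le ha e1') hL hk).le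

/-- the factor of the walk expansion (2.13) as an operator: `(K_hGh)Φ = K_h(G(hΦ))`.
[cite: Balaban1983RegularityDecay, (2.13) p. 577 «K_{ω₁}G_k(□_{ω₁},Ã_{ω₁})h_{ω₁}», dictionary] -/
theorem factor_mulVec {X : Type*} [Fintype X] [DecidableEq X] (K G : Matrix (X × ι) (X × ι) ℝ) (h : X → ℝ)
    (Φ : X × ι → ℝ) : (K * G * mulH (ι := ι) h) *ᵥ Φ = K *ᵥ (G *ᵥ (mulH (ι := ι) h *ᵥ Φ)) := by
  rw [← mulVec_mulVec, ← mulVec_mulVec]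

/-! ## §1. The factor bound at `Ã = A₀ + A′` on a box with a general contour system -/

section Box

/-- **(2.20) AT A REGULAR FIELD `Ã = A₀ + A′` ON A BOX — THE SUP-NORM FACTOR BOUND
«‖K_{ω_i}G_k(□_{ω_i},Ã_{ω_i})h_{ω_i}‖_∞ ≤ c₂O(1)M⁻¹»**: with the constant `c` of `B4Lemma22CrossSup.lemma22_17_sup_box`
(uniform on the window, all `k ≥ 1`, all boxes, all contour systems ending at the averaged point, all constant `A₀`),
IF `H_k(□,Ã)` is invertible, `A′` is antisymmetric with `|κA′_b| ≤ θ/n` on bonds, `|κ(A′(b′) − A′(b))| ≤ θ′/n²` on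
consecutive parallel bonds, `A′ = 0` on the bonds touching the faces, `|κA′(Γ_{y,x})| ≤ τ` along the block contours, and
the printed smallness holds, THEN for every `h` of sizes `(δ₁, δ₂, δ₃)` and every `Φ`:
`‖K_hG_k(□,Ã)(hΦ)‖_∞ ≤ (2(d+1)(1+ℓθ)δ₁ + δ₂ + a_kδ₃)·2(d+2)c·‖Φ‖_∞` — `c₂ = 2(d+2)c`, `O(1)M⁻¹` = the sizes of `h`
(p. 577 «|∂^ηh_j| ≤ O(M⁻¹), |Δ^ηh_j| ≤ O(M⁻²)»).  `eq220_field_reduction_sup` fed with the members `G`, `D^η_{Ã,μ}G` of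
(2.17) at `Ã` in the sup norm.
[cite: Balaban1983RegularityDecay, (2.20) p. 578 with (2.10) p. 576 and Lemma 2.2 (2.17) p. 578] -/
theorem eq220_sup_box (F : OrthFlow ι) {ℓ₁ : ℝ} (hℓ₁ : 0 ≤ ℓ₁)
    (hLip : ∀ t (v : ι → ℝ), ((F.U t - 1) *ᵥ v) ⬝ᵥ ((F.U t - 1) *ᵥ v) ≤ (ℓ₁ * t) ^ 2 * (v ⬝ᵥ v))
    (κ : ℝ) (d ℓ : ℕ) (hℓ : 1 ≤ ℓ) (amin aplus m2plus : ℝ) (ha : 0 < amin) :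
    ∃ c : ℝ, 0 < c ∧ ∀ (k : ℕ), 1 ≤ k → ∀ (a m2 : ℝ), amin ≤ a → a ≤ aplus → 0 ≤ m2 → m2 ≤ m2plus →
      ∀ (M : Fin (d + 1) → ℕ), (∀ i, 1 ≤ M i) →
      ∀ (emb : ↥(boxDom M) → ↥(Box d ℓ k M)) (Γ : ↥(boxDom M) → ↥(Box d ℓ k M) → List ↥(Box d ℓ k M)),
        (∀ y x, blkWt ((ℓ + 1) ^ k) M (fun i => (ℓ + 1) ^ k * M i) y x ≠ 0 → pathEnd (emb y) (Γ y x) = x) →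
      ∀ (A₀ : Fin (d + 1) → ℝ) (A' : ↥(Box d ℓ k M) → ↥(Box d ℓ k M) → ℝ) (θ θ' τ : ℝ),
        (∀ x y, A' y x = -A' x y) →
        IsUnit (opA d F κ ℓ k a m2 M emb Γ (constBond A₀ Subtype.val + A')).det →
        0 ≤ θ → (∀ x y : ↥(Box d ℓ k M), y.1 ∈ nbrs x.1 → |κ * A' x y| ≤ θ / ((ℓ + 1) ^ k : ℕ)) →
        0 ≤ θ' → (∀ (x z y : ↥(Box d ℓ k M)) (μ : Fin (d + 1)), z.1 = x.1 + e1 μ → y.1 = z.1 + e1 μ →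
          |κ * (A' y z - A' z x)| ≤ θ' / (((ℓ + 1) ^ k : ℕ) : ℝ) ^ 2 ∧
          |κ * (A' x z - A' z y)| ≤ θ' / (((ℓ + 1) ^ k : ℕ) : ℝ) ^ 2) →
        (∀ (x y : ↥(Box d ℓ k M)) (μ : Fin (d + 1)), y.1 = x.1 + e1 μ →
          (x.1 - e1 μ ∉ Box d ℓ k M ∨ y.1 + e1 μ ∉ Box d ℓ k M) → A' x y = 0 ∧ A' y x = 0) →
        0 ≤ τ → (∀ y x, blkWt ((ℓ + 1) ^ k) M (fun i => (ℓ + 1) ^ k * M i) y x ≠ 0 →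
          |κ * lsum A' (emb y) (Γ y x)| ≤ τ) →
        ((d : ℝ) + 2) * c * (((d : ℝ) + 1) * ℓ₁ * (θ + θ') + ((d : ℝ) + 1) * ℓ₁ * θ
          + ((d : ℝ) + 1) * ℓ₁ ^ 2 * θ ^ 2 + B1.aSeq a ((ℓ : ℝ) + 1) k * (ℓ₁ * τ * (2 + ℓ₁ * τ))) ≤ 1 / 2 →
        ∀ (δ₁ δ₂ δ₃ : ℝ) (h : ↥(Box d ℓ k M) → ℝ), HSize ((ℓ + 1) ^ k) M h δ₁ δ₂ δ₃ →
        ∀ Φ : ↥(Box d ℓ k M) × ι → ℝ,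
          supN (kOp F κ ((ℓ + 1) ^ k) (B1.aSeq a ((ℓ : ℝ) + 1) k) m2 M emb Γ (constBond A₀ Subtype.val + A') h
              *ᵥ (greenA d F κ ℓ k a m2 M emb Γ (constBond A₀ Subtype.val + A') *ᵥ (mulH (ι := ι) h *ᵥ Φ)))
            ≤ (2 * ((d : ℝ) + 1) * (1 + ℓ₁ * θ) * δ₁ + δ₂ + B1.aSeq a ((ℓ : ℝ) + 1) k * δ₃)
              * (2 * (((d : ℝ) + 2) * c)) * supN Φ := by
  obtain ⟨c, hc, hL⟩ := lemma22_17_sup_box F hℓ₁ hLip κ d ℓ hℓ amin aplus m2plus ha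
  refine ⟨c, hc, ?_⟩
  intro k hk a m2 e1' e2 e3 e4 M hM emb Γ hend A₀ A' θ θ' τ hanti' hunit hθ hA' hθ' hder hbd hτ0 hτ hsm δ₁ δ₂ δ₃ h hh
    Φ
  have hmem := hL k hk a m2 e1' e2 e3 e4 M hM emb Γ hend A₀ A' θ θ' τ hunit hθ hA' hθ' hder hbd hτ0 hτ hsm
  have hn : 1 ≤ (ℓ + 1) ^ k := Nat.one_le_pow _ _ (Nat.succ_pos ℓ)
  have hak := aSeq_nonneg hℓ hk ha e1'
  have hC0 : 0 ≤ 2 * (((d : ℝ) + 2) * c) := by positivity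
  have hC1 : 0 ≤ (1 + ℓ₁ * θ) * (2 * (((d : ℝ) + 2) * c)) := by positivity
  have hG : ∀ Ψ, supN (greenA d F κ ℓ k a m2 M emb Γ (constBond A₀ Subtype.val + A') *ᵥ Ψ)
      ≤ 2 * (((d : ℝ) + 2) * c) * supN Ψ := fun Ψ => by
    have h1 := (hmem Ψ).1
    have hS : 0 ≤ ∑ μ, supN (derivA0 d F κ ℓ k M A₀ μ
        *ᵥ (greenA d F κ ℓ k a m2 M emb Γ (constBond A₀ Subtype.val + A') *ᵥ Ψ)) :=
      sum_nonneg fun μ _ => supN_nonneg _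
    linarith
  have hred := eq220_field_reduction_sup (ν := supN) F κ (B1.aSeq a ((ℓ : ℝ) + 1) k) m2 M emb Γ
    (constBond A₀ Subtype.val + A') hn (field_antisymm A₀ _ hanti') hak hC0 hC1
    (greenA d F κ ℓ k a m2 M emb Γ (constBond A₀ Subtype.val + A')) hG (fun μ Ψ => (hmem Ψ).2 μ) hh Φ
    (supN_mulH_le hh.abs_le Φ)
  calc _ ≤ _ := hred
    _ = _ := by ring

/-- **(2.21) AT A REGULAR FIELD ON A BOX — THE FACTORS «‖K_{ω_i}G_k(□_{ω_i},Ã_{ω_i})h_{ω_i}‖_{p₁/(i−1),p₁/i}»,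
«‖·‖_{2,2}» ON THE WHOLE PRINTED PARALLELOGRAM `1 ≤ p ≤ q < ∞`, `1/p − 1/q ≤ 1/p₁`, `p₁ > d + 1`, WITH THE `η`-DECAY**:
with the constants `c`, `C` of `B4Lemma22EtaBox.lemma22_17_pq_box_eta`, under the same hypotheses as `eq220_sup_box`,
`‖K_hG_k(□,Ã)(hΦ)‖_q ≤ (2(d+1)(1+ℓθ)δ₁ + δ₂ + a_kδ₃)·2C·vol^{−(1/p−1/q)}·‖Φ‖_p` in counting-measure norms
(`vol = η^{−(d+1)}`; equivalently an `η`-independent constant in the print's `L^p(□)` norms, §2).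
[cite: Balaban1983RegularityDecay, (2.21) p. 578 with (2.10) p. 576 and Lemma 2.2 (2.17) p. 578] -/
theorem eq221_pq_box (F : OrthFlow ι) {ℓ₁ : ℝ} (hℓ₁ : 0 ≤ ℓ₁)
    (hLip : ∀ t (v : ι → ℝ), ((F.U t - 1) *ᵥ v) ⬝ᵥ ((F.U t - 1) *ᵥ v) ≤ (ℓ₁ * t) ^ 2 * (v ⬝ᵥ v))
    (κ : ℝ) (d ℓ : ℕ) (hℓ : 1 ≤ ℓ) (amin aplus m2plus : ℝ) (ha : 0 < amin) {p₁ : ℝ} (hp₁ : (d : ℝ) + 1 < p₁) :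
    ∃ c : ℝ, 0 < c ∧ ∃ C : ℝ, 0 < C ∧ ∀ (k : ℕ), 1 ≤ k → ∀ (a m2 : ℝ), amin ≤ a → a ≤ aplus → 0 ≤ m2 →
      m2 ≤ m2plus → ∀ (M : Fin (d + 1) → ℕ), (∀ i, 1 ≤ M i) →
      ∀ (emb : ↥(boxDom M) → ↥(Box d ℓ k M)) (Γ : ↥(boxDom M) → ↥(Box d ℓ k M) → List ↥(Box d ℓ k M)),
        (∀ y x, blkWt ((ℓ + 1) ^ k) M (fun i => (ℓ + 1) ^ k * M i) y x ≠ 0 → pathEnd (emb y) (Γ y x) = x) →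
      ∀ (A₀ : Fin (d + 1) → ℝ) (A' : ↥(Box d ℓ k M) → ↥(Box d ℓ k M) → ℝ) (θ θ' τ : ℝ),
        (∀ x y, A' y x = -A' x y) →
        IsUnit (opA d F κ ℓ k a m2 M emb Γ (constBond A₀ Subtype.val + A')).det →
        0 ≤ θ → (∀ x y : ↥(Box d ℓ k M), y.1 ∈ nbrs x.1 → |κ * A' x y| ≤ θ / ((ℓ + 1) ^ k : ℕ)) →
        0 ≤ θ' → (∀ (x z y : ↥(Box d ℓ k M)) (μ : Fin (d + 1)), z.1 = x.1 + e1 μ → y.1 = z.1 + e1 μ →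
          |κ * (A' y z - A' z x)| ≤ θ' / (((ℓ + 1) ^ k : ℕ) : ℝ) ^ 2 ∧
          |κ * (A' x z - A' z y)| ≤ θ' / (((ℓ + 1) ^ k : ℕ) : ℝ) ^ 2) →
        (∀ (x y : ↥(Box d ℓ k M)) (μ : Fin (d + 1)), y.1 = x.1 + e1 μ →
          (x.1 - e1 μ ∉ Box d ℓ k M ∨ y.1 + e1 μ ∉ Box d ℓ k M) → A' x y = 0 ∧ A' y x = 0) →
        0 ≤ τ → (∀ y x, blkWt ((ℓ + 1) ^ k) M (fun i => (ℓ + 1) ^ k * M i) y x ≠ 0 →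
          |κ * lsum A' (emb y) (Γ y x)| ≤ τ) →
        ((d : ℝ) + 2) * c * (((d : ℝ) + 1) * ℓ₁ * (θ + θ') + ((d : ℝ) + 1) * ℓ₁ * θ
          + ((d : ℝ) + 1) * ℓ₁ ^ 2 * θ ^ 2 + B1.aSeq a ((ℓ : ℝ) + 1) k * (ℓ₁ * τ * (2 + ℓ₁ * τ))) ≤ 1 / 2 →
        ∀ (p q : ℝ), 1 ≤ p → p ≤ q → p⁻¹ - q⁻¹ ≤ p₁⁻¹ →
        ∀ (δ₁ δ₂ δ₃ : ℝ) (h : ↥(Box d ℓ k M) → ℝ), HSize ((ℓ + 1) ^ k) M h δ₁ δ₂ δ₃ →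
        ∀ Φ : ↥(Box d ℓ k M) × ι → ℝ,
          lpM q (kOp F κ ((ℓ + 1) ^ k) (B1.aSeq a ((ℓ : ℝ) + 1) k) m2 M emb Γ (constBond A₀ Subtype.val + A') h
              *ᵥ (greenA d F κ ℓ k a m2 M emb Γ (constBond A₀ Subtype.val + A') *ᵥ (mulH (ι := ι) h *ᵥ Φ)))
            ≤ (2 * ((d : ℝ) + 1) * (1 + ℓ₁ * θ) * δ₁ + δ₂ + B1.aSeq a ((ℓ : ℝ) + 1) k * δ₃)
              * (2 * (C * (vol d ℓ k ^ (p⁻¹ - q⁻¹))⁻¹)) * lpM p Φ := by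
  obtain ⟨c, hc, C, hC, hL⟩ := lemma22_17_pq_box_eta F hℓ₁ hLip κ d ℓ hℓ amin aplus m2plus ha hp₁
  refine ⟨c, hc, C, hC, ?_⟩
  intro k hk a m2 e1' e2 e3 e4 M hM emb Γ hend A₀ A' θ θ' τ hanti' hunit hθ hA' hθ' hder hbd hτ0 hτ hsm p q hp hpq hσ
    δ₁ δ₂ δ₃ h hh Φ
  have hmem := hL k hk a m2 e1' e2 e3 e4 M hM emb Γ hend A₀ A' θ θ' τ hunit hθ hA' hθ' hder hbd hτ0 hτ hsm p q hp hpq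
    hσ
  have hn : 1 ≤ (ℓ + 1) ^ k := Nat.one_le_pow _ _ (Nat.succ_pos ℓ)
  have hak := aSeq_nonneg hℓ hk ha e1'
  have hp0 : 0 < p := by linarith
  have hC0 : 0 ≤ 2 * (C * (vol d ℓ k ^ (p⁻¹ - q⁻¹))⁻¹) :=
    mul_nonneg zero_le_two (mul_nonneg hC.le (inv_nonneg.2 (Real.rpow_nonneg (vol_pos d ℓ k).le _)))
  have hC1 : 0 ≤ (1 + ℓ₁ * θ) * (2 * (C * (vol d ℓ k ^ (p⁻¹ - q⁻¹))⁻¹)) := by positivity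
  have hred := eq220_field_reduction_lp (ν := lpM p) F κ (B1.aSeq a ((ℓ : ℝ) + 1) k) m2 M emb Γ
    (constBond A₀ Subtype.val + A') hn (field_antisymm A₀ _ hanti') hak (hp.trans hpq) hC0 hC1
    (greenA d F κ ℓ k a m2 M emb Γ (constBond A₀ Subtype.val + A')) (fun Ψ => (hmem Ψ).1)
    (fun μ Ψ => (hmem Ψ).2.2 μ) hh Φ (lpM_mulH_le hp0 hh.abs_le Φ)
  calc _ ≤ _ := hred
    _ = _ := by ring

/-- **THE FIRST FACTOR OF (2.21) «‖K_{ω₁}G_k(□_{ω₁},Ã_{ω₁})h_{ω₁}‖_{∞,p₁}» AT A REGULAR FIELD ON A BOX** (the edge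
`q = ∞`, `p ≥ p₁ > d + 1` of the parallelogram): with the constants of `B4Lemma22EtaBox.lemma22_17_psup_box_eta`,
`‖K_hG_k(□,Ã)(hΦ)‖_∞ ≤ (2(d+1)(1+ℓθ)δ₁ + δ₂ + a_kδ₃)·2C·vol^{−1/p}·‖Φ‖_p` (`= …·2C‖Φ‖_{p,η}`).
[cite: Balaban1983RegularityDecay, (2.21) p. 578 with (2.10) p. 576 and Lemma 2.2 (2.17) p. 578, (2.41) p. 583] -/
theorem eq221_psup_box (F : OrthFlow ι) {ℓ₁ : ℝ} (hℓ₁ : 0 ≤ ℓ₁)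
    (hLip : ∀ t (v : ι → ℝ), ((F.U t - 1) *ᵥ v) ⬝ᵥ ((F.U t - 1) *ᵥ v) ≤ (ℓ₁ * t) ^ 2 * (v ⬝ᵥ v))
    (κ : ℝ) (d ℓ : ℕ) (hℓ : 1 ≤ ℓ) (amin aplus m2plus : ℝ) (ha : 0 < amin) {p₁ : ℝ} (hp₁ : (d : ℝ) + 1 < p₁) :
    ∃ c : ℝ, 0 < c ∧ ∃ C : ℝ, 0 < C ∧ ∀ (k : ℕ), 1 ≤ k → ∀ (a m2 : ℝ), amin ≤ a → a ≤ aplus → 0 ≤ m2 →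
      m2 ≤ m2plus → ∀ (M : Fin (d + 1) → ℕ), (∀ i, 1 ≤ M i) →
      ∀ (emb : ↥(boxDom M) → ↥(Box d ℓ k M)) (Γ : ↥(boxDom M) → ↥(Box d ℓ k M) → List ↥(Box d ℓ k M)),
        (∀ y x, blkWt ((ℓ + 1) ^ k) M (fun i => (ℓ + 1) ^ k * M i) y x ≠ 0 → pathEnd (emb y) (Γ y x) = x) →
      ∀ (A₀ : Fin (d + 1) → ℝ) (A' : ↥(Box d ℓ k M) → ↥(Box d ℓ k M) → ℝ) (θ θ' τ : ℝ),
        (∀ x y, A' y x = -A' x y) →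
        IsUnit (opA d F κ ℓ k a m2 M emb Γ (constBond A₀ Subtype.val + A')).det →
        0 ≤ θ → (∀ x y : ↥(Box d ℓ k M), y.1 ∈ nbrs x.1 → |κ * A' x y| ≤ θ / ((ℓ + 1) ^ k : ℕ)) →
        0 ≤ θ' → (∀ (x z y : ↥(Box d ℓ k M)) (μ : Fin (d + 1)), z.1 = x.1 + e1 μ → y.1 = z.1 + e1 μ →
          |κ * (A' y z - A' z x)| ≤ θ' / (((ℓ + 1) ^ k : ℕ) : ℝ) ^ 2 ∧
          |κ * (A' x z - A' z y)| ≤ θ' / (((ℓ + 1) ^ k : ℕ) : ℝ) ^ 2) →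
        (∀ (x y : ↥(Box d ℓ k M)) (μ : Fin (d + 1)), y.1 = x.1 + e1 μ →
          (x.1 - e1 μ ∉ Box d ℓ k M ∨ y.1 + e1 μ ∉ Box d ℓ k M) → A' x y = 0 ∧ A' y x = 0) →
        0 ≤ τ → (∀ y x, blkWt ((ℓ + 1) ^ k) M (fun i => (ℓ + 1) ^ k * M i) y x ≠ 0 →
          |κ * lsum A' (emb y) (Γ y x)| ≤ τ) →
        ((d : ℝ) + 2) * c * (((d : ℝ) + 1) * ℓ₁ * (θ + θ') + ((d : ℝ) + 1) * ℓ₁ * θ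
          + ((d : ℝ) + 1) * ℓ₁ ^ 2 * θ ^ 2 + B1.aSeq a ((ℓ : ℝ) + 1) k * (ℓ₁ * τ * (2 + ℓ₁ * τ))) ≤ 1 / 2 →
        ∀ (p : ℝ), p₁ ≤ p →
        ∀ (δ₁ δ₂ δ₃ : ℝ) (h : ↥(Box d ℓ k M) → ℝ), HSize ((ℓ + 1) ^ k) M h δ₁ δ₂ δ₃ →
        ∀ Φ : ↥(Box d ℓ k M) × ι → ℝ,
          supN (kOp F κ ((ℓ + 1) ^ k) (B1.aSeq a ((ℓ : ℝ) + 1) k) m2 M emb Γ (constBond A₀ Subtype.val + A') h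
              *ᵥ (greenA d F κ ℓ k a m2 M emb Γ (constBond A₀ Subtype.val + A') *ᵥ (mulH (ι := ι) h *ᵥ Φ)))
            ≤ (2 * ((d : ℝ) + 1) * (1 + ℓ₁ * θ) * δ₁ + δ₂ + B1.aSeq a ((ℓ : ℝ) + 1) k * δ₃)
              * (2 * (C * (vol d ℓ k ^ p⁻¹)⁻¹)) * lpM p Φ := by
  obtain ⟨c, hc, C, hC, hL⟩ := lemma22_17_psup_box_eta F hℓ₁ hLip κ d ℓ hℓ amin aplus m2plus ha hp₁
  refine ⟨c, hc, C, hC, ?_⟩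
  intro k hk a m2 e1' e2 e3 e4 M hM emb Γ hend A₀ A' θ θ' τ hanti' hunit hθ hA' hθ' hder hbd hτ0 hτ hsm p hp
    δ₁ δ₂ δ₃ h hh Φ
  have hmem := hL k hk a m2 e1' e2 e3 e4 M hM emb Γ hend A₀ A' θ θ' τ hunit hθ hA' hθ' hder hbd hτ0 hτ hsm p hp
  have hn : 1 ≤ (ℓ + 1) ^ k := Nat.one_le_pow _ _ (Nat.succ_pos ℓ)
  have hak := aSeq_nonneg hℓ hk ha e1'
  have hd0 : (0 : ℝ) ≤ d := Nat.cast_nonneg d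
  have hp0 : 0 < p := by linarith
  have hC0 : 0 ≤ 2 * (C * (vol d ℓ k ^ p⁻¹)⁻¹) :=
    mul_nonneg zero_le_two (mul_nonneg hC.le (inv_nonneg.2 (Real.rpow_nonneg (vol_pos d ℓ k).le _)))
  have hC1 : 0 ≤ (1 + ℓ₁ * θ) * (2 * (C * (vol d ℓ k ^ p⁻¹)⁻¹)) := by positivity
  have hred := eq220_field_reduction_sup (ν := lpM p) F κ (B1.aSeq a ((ℓ : ℝ) + 1) k) m2 M emb Γ
    (constBond A₀ Subtype.val + A') hn (field_antisymm A₀ _ hanti') hak hC0 hC1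
    (greenA d F κ ℓ k a m2 M emb Γ (constBond A₀ Subtype.val + A')) (fun Ψ => (hmem Ψ).1)
    (fun μ Ψ => (hmem Ψ).2.2 μ) hh Φ (lpM_mulH_le hp0 hh.abs_le Φ)
  calc _ ≤ _ := hred
    _ = _ := by ring

end Box

/-! ## §2. Staircase contours: the operator-side hypotheses discharged; the `η`-weighted norms -/

section Stair

/-- **(2.20) AT A REGULAR FIELD ON A BOX WITH THE STAIRCASE CONTOURS OF `B4Lower18Regular` — EVERYTHING DISCHARGED BUT
THE PRINTED SMALLNESS OF THE FIELD** (invertibility of `H_k(□,Ã)` and the contour sums from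
`B4Lemma22SupStair.lemma22_17_sup_stair`): for `A′` antisymmetric, of bond size `θ/n`, bond derivative `θ′/n²`,
vanishing on the bonds touching the faces, and the two smallness conditions, for every `h` of sizes `(δ₁, δ₂, δ₃)` and
every `Φ`: `‖K_hG_k(□,Ã)(hΦ)‖_∞ ≤ (2(d+1)(1+ℓθ)δ₁ + δ₂ + a_kδ₃)·2(d+2)c·‖Φ‖_∞`.
[cite: Balaban1983RegularityDecay, (2.20) p. 578 with (2.10) p. 576 and Lemma 2.2 (2.17) p. 578] -/
theorem eq220_sup_stair (F : OrthFlow ι) {ℓ₁ : ℝ} (hℓ₁ : 0 ≤ ℓ₁)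
    (hLip : ∀ t (v : ι → ℝ), ((F.U t - 1) *ᵥ v) ⬝ᵥ ((F.U t - 1) *ᵥ v) ≤ (ℓ₁ * t) ^ 2 * (v ⬝ᵥ v))
    (κ : ℝ) (d ℓ : ℕ) (hℓ : 1 ≤ ℓ) (amin aplus m2plus : ℝ) (ha : 0 < amin) :
    ∃ c : ℝ, 0 < c ∧ ∀ (k : ℕ), 1 ≤ k → ∀ (hn : 1 ≤ (ℓ + 1) ^ k) (a m2 : ℝ),
      amin ≤ a → a ≤ aplus → 0 ≤ m2 → m2 ≤ m2plus →
      ∀ (M : Fin (d + 1) → ℕ), (∀ i, 1 ≤ M i) →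
      ∀ (A₀ : Fin (d + 1) → ℝ) (A' : ↥(Box d ℓ k M) → ↥(Box d ℓ k M) → ℝ) (θ θ' : ℝ),
        (∀ x y, A' y x = -A' x y) →
        0 ≤ θ → (∀ x y : ↥(Box d ℓ k M), y.1 ∈ nbrs x.1 → |κ * A' x y| ≤ θ / ((ℓ + 1) ^ k : ℕ)) →
        0 ≤ θ' → (∀ (x z y : ↥(Box d ℓ k M)) (μ : Fin (d + 1)), z.1 = x.1 + e1 μ → y.1 = z.1 + e1 μ →
          |κ * (A' y z - A' z x)| ≤ θ' / (((ℓ + 1) ^ k : ℕ) : ℝ) ^ 2 ∧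
          |κ * (A' x z - A' z y)| ≤ θ' / (((ℓ + 1) ^ k : ℕ) : ℝ) ^ 2) →
        (∀ (x y : ↥(Box d ℓ k M)) (μ : Fin (d + 1)), y.1 = x.1 + e1 μ →
          (x.1 - e1 μ ∉ Box d ℓ k M ∨ y.1 + e1 μ ∉ Box d ℓ k M) → A' x y = 0 ∧ A' y x = 0) →
        ℓ₁ ^ 2 * θ ^ 2 * ((d : ℝ) + 1) * (1 + B1.aSeq a ((ℓ : ℝ) + 1) k * ((d : ℝ) + 1))
          ≤ min 2 (B1.aSeq a ((ℓ : ℝ) + 1) k) / 4 →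
        ((d : ℝ) + 2) * c * (((d : ℝ) + 1) * ℓ₁ * (θ + θ') + ((d : ℝ) + 1) * ℓ₁ * θ
          + ((d : ℝ) + 1) * ℓ₁ ^ 2 * θ ^ 2
          + B1.aSeq a ((ℓ : ℝ) + 1) k * (ℓ₁ * (((d : ℝ) + 1) * θ) * (2 + ℓ₁ * (((d : ℝ) + 1) * θ)))) ≤ 1 / 2 →
        ∀ (δ₁ δ₂ δ₃ : ℝ) (h : ↥(Box d ℓ k M) → ℝ), HSize ((ℓ + 1) ^ k) M h δ₁ δ₂ δ₃ →
        ∀ Φ : ↥(Box d ℓ k M) × ι → ℝ,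
          supN (kOp F κ ((ℓ + 1) ^ k) (B1.aSeq a ((ℓ : ℝ) + 1) k) m2 M (baseEmb hn M) (stairContour hn M)
                (constBond A₀ Subtype.val + A') h
              *ᵥ (greenA d F κ ℓ k a m2 M (baseEmb hn M) (stairContour hn M) (constBond A₀ Subtype.val + A')
                  *ᵥ (mulH (ι := ι) h *ᵥ Φ)))
            ≤ (2 * ((d : ℝ) + 1) * (1 + ℓ₁ * θ) * δ₁ + δ₂ + B1.aSeq a ((ℓ : ℝ) + 1) k * δ₃)
              * (2 * (((d : ℝ) + 2) * c)) * supN Φ := by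
  obtain ⟨c, hc, hL⟩ := lemma22_17_sup_stair F hℓ₁ hLip κ d ℓ hℓ amin aplus m2plus ha
  refine ⟨c, hc, ?_⟩
  intro k hk hn a m2 e1' e2 e3 e4 M hM A₀ A' θ θ' hanti' hθ hA' hθ' hder hbd hsm2 hsm δ₁ δ₂ δ₃ h hh Φ
  have hmem := hL k hk hn a m2 e1' e2 e3 e4 M hM A₀ A' θ θ' hθ hA' hθ' hder hbd hsm2 hsm
  have hak := aSeq_nonneg hℓ hk ha e1'
  have hC0 : 0 ≤ 2 * (((d : ℝ) + 2) * c) := by positivity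
  have hC1 : 0 ≤ (1 + ℓ₁ * θ) * (2 * (((d : ℝ) + 2) * c)) := by positivity
  have hG : ∀ Ψ, supN (greenA d F κ ℓ k a m2 M (baseEmb hn M) (stairContour hn M) (constBond A₀ Subtype.val + A')
      *ᵥ Ψ) ≤ 2 * (((d : ℝ) + 2) * c) * supN Ψ := fun Ψ => by
    have h1 := (hmem Ψ).1
    have hS : 0 ≤ ∑ μ, supN (derivA0 d F κ ℓ k M A₀ μ
        *ᵥ (greenA d F κ ℓ k a m2 M (baseEmb hn M) (stairContour hn M) (constBond A₀ Subtype.val + A') *ᵥ Ψ)) :=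
      sum_nonneg fun μ _ => supN_nonneg _
    linarith
  have hred := eq220_field_reduction_sup (ν := supN) F κ (B1.aSeq a ((ℓ : ℝ) + 1) k) m2 M (baseEmb hn M)
    (stairContour hn M) (constBond A₀ Subtype.val + A') hn (field_antisymm A₀ _ hanti') hak hC0 hC1
    (greenA d F κ ℓ k a m2 M (baseEmb hn M) (stairContour hn M) (constBond A₀ Subtype.val + A')) hG
    (fun μ Ψ => (hmem Ψ).2 μ) hh Φ (supN_mulH_le hh.abs_le Φ)
  calc _ ≤ _ := hred
    _ = _ := by ring

/-- **(2.21) AT A REGULAR FIELD ON A BOX WITH THE STAIRCASE CONTOURS, THE WHOLE PARALLELOGRAM `1 ≤ p ≤ q < ∞`,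
`1/p − 1/q ≤ 1/p₁`, WITH THE `η`-DECAY — everything discharged but the printed smallness of the field**:
`‖K_hG_k(□,Ã)(hΦ)‖_q ≤ (2(d+1)(1+ℓθ)δ₁ + δ₂ + a_kδ₃)·2C·vol^{−(1/p−1/q)}·‖Φ‖_p`.
[cite: Balaban1983RegularityDecay, (2.21) p. 578 with (2.10) p. 576 and Lemma 2.2 (2.17) p. 578] -/
theorem eq221_pq_stair (F : OrthFlow ι) {ℓ₁ : ℝ} (hℓ₁ : 0 ≤ ℓ₁)
    (hLip : ∀ t (v : ι → ℝ), ((F.U t - 1) *ᵥ v) ⬝ᵥ ((F.U t - 1) *ᵥ v) ≤ (ℓ₁ * t) ^ 2 * (v ⬝ᵥ v))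
    (κ : ℝ) (d ℓ : ℕ) (hℓ : 1 ≤ ℓ) (amin aplus m2plus : ℝ) (ha : 0 < amin) {p₁ : ℝ} (hp₁ : (d : ℝ) + 1 < p₁) :
    ∃ c : ℝ, 0 < c ∧ ∃ C : ℝ, 0 < C ∧ ∀ (k : ℕ), 1 ≤ k → ∀ (hn : 1 ≤ (ℓ + 1) ^ k) (a m2 : ℝ),
      amin ≤ a → a ≤ aplus → 0 ≤ m2 → m2 ≤ m2plus →
      ∀ (M : Fin (d + 1) → ℕ), (∀ i, 1 ≤ M i) →
      ∀ (A₀ : Fin (d + 1) → ℝ) (A' : ↥(Box d ℓ k M) → ↥(Box d ℓ k M) → ℝ) (θ θ' : ℝ),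
        (∀ x y, A' y x = -A' x y) →
        0 ≤ θ → (∀ x y : ↥(Box d ℓ k M), y.1 ∈ nbrs x.1 → |κ * A' x y| ≤ θ / ((ℓ + 1) ^ k : ℕ)) →
        0 ≤ θ' → (∀ (x z y : ↥(Box d ℓ k M)) (μ : Fin (d + 1)), z.1 = x.1 + e1 μ → y.1 = z.1 + e1 μ →
          |κ * (A' y z - A' z x)| ≤ θ' / (((ℓ + 1) ^ k : ℕ) : ℝ) ^ 2 ∧
          |κ * (A' x z - A' z y)| ≤ θ' / (((ℓ + 1) ^ k : ℕ) : ℝ) ^ 2) →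
        (∀ (x y : ↥(Box d ℓ k M)) (μ : Fin (d + 1)), y.1 = x.1 + e1 μ →
          (x.1 - e1 μ ∉ Box d ℓ k M ∨ y.1 + e1 μ ∉ Box d ℓ k M) → A' x y = 0 ∧ A' y x = 0) →
        ℓ₁ ^ 2 * θ ^ 2 * ((d : ℝ) + 1) * (1 + B1.aSeq a ((ℓ : ℝ) + 1) k * ((d : ℝ) + 1))
          ≤ min 2 (B1.aSeq a ((ℓ : ℝ) + 1) k) / 4 →
        ((d : ℝ) + 2) * c * (((d : ℝ) + 1) * ℓ₁ * (θ + θ') + ((d : ℝ) + 1) * ℓ₁ * θ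
          + ((d : ℝ) + 1) * ℓ₁ ^ 2 * θ ^ 2
          + B1.aSeq a ((ℓ : ℝ) + 1) k * (ℓ₁ * (((d : ℝ) + 1) * θ) * (2 + ℓ₁ * (((d : ℝ) + 1) * θ)))) ≤ 1 / 2 →
        ∀ (p q : ℝ), 1 ≤ p → p ≤ q → p⁻¹ - q⁻¹ ≤ p₁⁻¹ →
        ∀ (δ₁ δ₂ δ₃ : ℝ) (h : ↥(Box d ℓ k M) → ℝ), HSize ((ℓ + 1) ^ k) M h δ₁ δ₂ δ₃ →
        ∀ Φ : ↥(Box d ℓ k M) × ι → ℝ,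
          lpM q (kOp F κ ((ℓ + 1) ^ k) (B1.aSeq a ((ℓ : ℝ) + 1) k) m2 M (baseEmb hn M) (stairContour hn M)
                (constBond A₀ Subtype.val + A') h
              *ᵥ (greenA d F κ ℓ k a m2 M (baseEmb hn M) (stairContour hn M) (constBond A₀ Subtype.val + A')
                  *ᵥ (mulH (ι := ι) h *ᵥ Φ)))
            ≤ (2 * ((d : ℝ) + 1) * (1 + ℓ₁ * θ) * δ₁ + δ₂ + B1.aSeq a ((ℓ : ℝ) + 1) k * δ₃)
              * (2 * (C * (vol d ℓ k ^ (p⁻¹ - q⁻¹))⁻¹)) * lpM p Φ := by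
  obtain ⟨c, hc, C, hC, hL⟩ := lemma22_17_pq_stair_eta F hℓ₁ hLip κ d ℓ hℓ amin aplus m2plus ha hp₁
  refine ⟨c, hc, C, hC, ?_⟩
  intro k hk hn a m2 e1' e2 e3 e4 M hM A₀ A' θ θ' hanti' hθ hA' hθ' hder hbd hsm2 hsm p q hp hpq hσ δ₁ δ₂ δ₃ h hh Φ
  have hmem := hL k hk hn a m2 e1' e2 e3 e4 M hM A₀ A' θ θ' hθ hA' hθ' hder hbd hsm2 hsm p q hp hpq hσ
  have hak := aSeq_nonneg hℓ hk ha e1'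
  have hp0 : 0 < p := by linarith
  have hC0 : 0 ≤ 2 * (C * (vol d ℓ k ^ (p⁻¹ - q⁻¹))⁻¹) :=
    mul_nonneg zero_le_two (mul_nonneg hC.le (inv_nonneg.2 (Real.rpow_nonneg (vol_pos d ℓ k).le _)))
  have hC1 : 0 ≤ (1 + ℓ₁ * θ) * (2 * (C * (vol d ℓ k ^ (p⁻¹ - q⁻¹))⁻¹)) := by positivity
  have hred := eq220_field_reduction_lp (ν := lpM p) F κ (B1.aSeq a ((ℓ : ℝ) + 1) k) m2 M (baseEmb hn M)
    (stairContour hn M) (constBond A₀ Subtype.val + A') hn (field_antisymm A₀ _ hanti') hak (hp.trans hpq) hC0 hC1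
    (greenA d F κ ℓ k a m2 M (baseEmb hn M) (stairContour hn M) (constBond A₀ Subtype.val + A'))
    (fun Ψ => (hmem Ψ).1) (fun μ Ψ => (hmem Ψ).2.2 μ) hh Φ (lpM_mulH_le hp0 hh.abs_le Φ)
  calc _ ≤ _ := hred
    _ = _ := by ring

/-- **(2.21) IN THE PRINT'S `η`-WEIGHTED NORMS `‖·‖_{p,η}` (`B4Lemma22EtaBox.lpW`), THE CONSTANT INDEPENDENT OF `η`** —
staircase contours, the whole parallelogram `1 ≤ p ≤ q < ∞`, `1/p − 1/q ≤ 1/p₁`: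
`‖K_hG_k(□,Ã)(hΦ)‖_{q,η} ≤ (2(d+1)(1+ℓθ)δ₁ + δ₂ + a_kδ₃)·2C·‖Φ‖_{p,η}` — «‖T‖_{q,p} denotes a norm of an operator
T : L^p → L^q» (p. 579) for the factors of (2.21), uniformly in `k` (`η = L^{-k}`), the window and the box.
[cite: Balaban1983RegularityDecay, (2.21) p. 578, p. 579, with (2.10) p. 576 and Lemma 2.2 (2.17) p. 578] -/
theorem eq221_weighted_stair (F : OrthFlow ι) {ℓ₁ : ℝ} (hℓ₁ : 0 ≤ ℓ₁)
    (hLip : ∀ t (v : ι → ℝ), ((F.U t - 1) *ᵥ v) ⬝ᵥ ((F.U t - 1) *ᵥ v) ≤ (ℓ₁ * t) ^ 2 * (v ⬝ᵥ v))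
    (κ : ℝ) (d ℓ : ℕ) (hℓ : 1 ≤ ℓ) (amin aplus m2plus : ℝ) (ha : 0 < amin) {p₁ : ℝ} (hp₁ : (d : ℝ) + 1 < p₁) :
    ∃ c : ℝ, 0 < c ∧ ∃ C : ℝ, 0 < C ∧ ∀ (k : ℕ), 1 ≤ k → ∀ (hn : 1 ≤ (ℓ + 1) ^ k) (a m2 : ℝ),
      amin ≤ a → a ≤ aplus → 0 ≤ m2 → m2 ≤ m2plus →
      ∀ (M : Fin (d + 1) → ℕ), (∀ i, 1 ≤ M i) →
      ∀ (A₀ : Fin (d + 1) → ℝ) (A' : ↥(Box d ℓ k M) → ↥(Box d ℓ k M) → ℝ) (θ θ' : ℝ),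
        (∀ x y, A' y x = -A' x y) →
        0 ≤ θ → (∀ x y : ↥(Box d ℓ k M), y.1 ∈ nbrs x.1 → |κ * A' x y| ≤ θ / ((ℓ + 1) ^ k : ℕ)) →
        0 ≤ θ' → (∀ (x z y : ↥(Box d ℓ k M)) (μ : Fin (d + 1)), z.1 = x.1 + e1 μ → y.1 = z.1 + e1 μ →
          |κ * (A' y z - A' z x)| ≤ θ' / (((ℓ + 1) ^ k : ℕ) : ℝ) ^ 2 ∧
          |κ * (A' x z - A' z y)| ≤ θ' / (((ℓ + 1) ^ k : ℕ) : ℝ) ^ 2) →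
        (∀ (x y : ↥(Box d ℓ k M)) (μ : Fin (d + 1)), y.1 = x.1 + e1 μ →
          (x.1 - e1 μ ∉ Box d ℓ k M ∨ y.1 + e1 μ ∉ Box d ℓ k M) → A' x y = 0 ∧ A' y x = 0) →
        ℓ₁ ^ 2 * θ ^ 2 * ((d : ℝ) + 1) * (1 + B1.aSeq a ((ℓ : ℝ) + 1) k * ((d : ℝ) + 1))
          ≤ min 2 (B1.aSeq a ((ℓ : ℝ) + 1) k) / 4 →
        ((d : ℝ) + 2) * c * (((d : ℝ) + 1) * ℓ₁ * (θ + θ') + ((d : ℝ) + 1) * ℓ₁ * θ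
          + ((d : ℝ) + 1) * ℓ₁ ^ 2 * θ ^ 2
          + B1.aSeq a ((ℓ : ℝ) + 1) k * (ℓ₁ * (((d : ℝ) + 1) * θ) * (2 + ℓ₁ * (((d : ℝ) + 1) * θ)))) ≤ 1 / 2 →
        ∀ (p q : ℝ), 1 ≤ p → p ≤ q → p⁻¹ - q⁻¹ ≤ p₁⁻¹ →
        ∀ (δ₁ δ₂ δ₃ : ℝ) (h : ↥(Box d ℓ k M) → ℝ), HSize ((ℓ + 1) ^ k) M h δ₁ δ₂ δ₃ →
        ∀ Φ : ↥(Box d ℓ k M) × ι → ℝ,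
          lpW d ℓ k q (kOp F κ ((ℓ + 1) ^ k) (B1.aSeq a ((ℓ : ℝ) + 1) k) m2 M (baseEmb hn M) (stairContour hn M)
                (constBond A₀ Subtype.val + A') h
              *ᵥ (greenA d F κ ℓ k a m2 M (baseEmb hn M) (stairContour hn M) (constBond A₀ Subtype.val + A')
                  *ᵥ (mulH (ι := ι) h *ᵥ Φ)))
            ≤ (2 * ((d : ℝ) + 1) * (1 + ℓ₁ * θ) * δ₁ + δ₂ + B1.aSeq a ((ℓ : ℝ) + 1) k * δ₃) * (2 * C)
              * lpW d ℓ k p Φ := by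
  obtain ⟨c, hc, C, hC, hL⟩ := eq221_pq_stair F hℓ₁ hLip κ d ℓ hℓ amin aplus m2plus ha hp₁
  refine ⟨c, hc, C, hC, ?_⟩
  intro k hk hn a m2 e1' e2 e3 e4 M hM A₀ A' θ θ' hanti' hθ hA' hθ' hder hbd hsm2 hsm p q hp hpq hσ δ₁ δ₂ δ₃ h hh Φ
  have h0 := hL k hk hn a m2 e1' e2 e3 e4 M hM A₀ A' θ θ' hanti' hθ hA' hθ' hder hbd hsm2 hsm p q hp hpq hσ δ₁ δ₂ δ₃
    h hh Φ
  exact lpW_le_of_lpM (h0.trans (le_of_eq (by ring)))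

end Stair

/-! ## §3. [B4]'s own partition function `h_j`: «c₂O(1)M⁻¹» at `Ã` -/

section Concrete

/-- **«‖K_jG_k(□_j,Ã_j)h_j‖_∞ ≤ c₂O(1)M⁻¹» FOR [B4]'s OWN `h_j` AT A REGULAR FIELD ON A BOX** (staircase contours;
box sides `M_μ` multiples of the large-cube size `K ≥ 2` — the print's `M` —; `h_j = B4Eq220PartitionSizes.hBox`, sizes
`hsize_hBox`): `‖K_{h_j}G_k(□,Ã)(h_jΦ)‖_∞ ≤ (2(d+1)(1+ℓθ) + 1 + a_k)·s·K⁻¹·2(d+2)c·‖Φ‖_∞`, `s = (d+1)(D1(h) + D2(h))`.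
[cite: Balaban1983RegularityDecay, (2.20) p. 578 «c₂O(1)M⁻¹» with p. 575 (h_j), p. 577 «|∂^ηh_j| ≤ O(M⁻¹), |Δ^ηh_j| ≤ O(M⁻²)»] -/
theorem eq220_hBox_sup_stair (F : OrthFlow ι) {ℓ₁ : ℝ} (hℓ₁ : 0 ≤ ℓ₁)
    (hLip : ∀ t (v : ι → ℝ), ((F.U t - 1) *ᵥ v) ⬝ᵥ ((F.U t - 1) *ᵥ v) ≤ (ℓ₁ * t) ^ 2 * (v ⬝ᵥ v))
    (κ : ℝ) (d ℓ : ℕ) (hℓ : 1 ≤ ℓ) (amin aplus m2plus : ℝ) (ha : 0 < amin) :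
    ∃ c : ℝ, 0 < c ∧ ∀ (k : ℕ), 1 ≤ k → ∀ (hn : 1 ≤ (ℓ + 1) ^ k) (a m2 : ℝ),
      amin ≤ a → a ≤ aplus → 0 ≤ m2 → m2 ≤ m2plus →
      ∀ (M : Fin (d + 1) → ℕ), (∀ i, 1 ≤ M i) → ∀ (K : ℕ) (j : Fin (d + 1) → ℤ), 2 ≤ K → (∀ μ, K ∣ M μ) →
      ∀ (A₀ : Fin (d + 1) → ℝ) (A' : ↥(Box d ℓ k M) → ↥(Box d ℓ k M) → ℝ) (θ θ' : ℝ),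
        (∀ x y, A' y x = -A' x y) →
        0 ≤ θ → (∀ x y : ↥(Box d ℓ k M), y.1 ∈ nbrs x.1 → |κ * A' x y| ≤ θ / ((ℓ + 1) ^ k : ℕ)) →
        0 ≤ θ' → (∀ (x z y : ↥(Box d ℓ k M)) (μ : Fin (d + 1)), z.1 = x.1 + e1 μ → y.1 = z.1 + e1 μ →
          |κ * (A' y z - A' z x)| ≤ θ' / (((ℓ + 1) ^ k : ℕ) : ℝ) ^ 2 ∧
          |κ * (A' x z - A' z y)| ≤ θ' / (((ℓ + 1) ^ k : ℕ) : ℝ) ^ 2) →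
        (∀ (x y : ↥(Box d ℓ k M)) (μ : Fin (d + 1)), y.1 = x.1 + e1 μ →
          (x.1 - e1 μ ∉ Box d ℓ k M ∨ y.1 + e1 μ ∉ Box d ℓ k M) → A' x y = 0 ∧ A' y x = 0) →
        ℓ₁ ^ 2 * θ ^ 2 * ((d : ℝ) + 1) * (1 + B1.aSeq a ((ℓ : ℝ) + 1) k * ((d : ℝ) + 1))
          ≤ min 2 (B1.aSeq a ((ℓ : ℝ) + 1) k) / 4 →
        ((d : ℝ) + 2) * c * (((d : ℝ) + 1) * ℓ₁ * (θ + θ') + ((d : ℝ) + 1) * ℓ₁ * θ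
          + ((d : ℝ) + 1) * ℓ₁ ^ 2 * θ ^ 2
          + B1.aSeq a ((ℓ : ℝ) + 1) k * (ℓ₁ * (((d : ℝ) + 1) * θ) * (2 + ℓ₁ * (((d : ℝ) + 1) * θ)))) ≤ 1 / 2 →
        ∀ Φ : ↥(Box d ℓ k M) × ι → ℝ,
          supN (kOp F κ ((ℓ + 1) ^ k) (B1.aSeq a ((ℓ : ℝ) + 1) k) m2 M (baseEmb hn M) (stairContour hn M)
                (constBond A₀ Subtype.val + A') (hBox ((ℓ + 1) ^ k) K M j)
              *ᵥ (greenA d F κ ℓ k a m2 M (baseEmb hn M) (stairContour hn M) (constBond A₀ Subtype.val + A')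
                  *ᵥ (mulH (ι := ι) (hBox ((ℓ + 1) ^ k) K M j) *ᵥ Φ)))
            ≤ (2 * ((d : ℝ) + 1) * (1 + ℓ₁ * θ) + 1 + B1.aSeq a ((ℓ : ℝ) + 1) k)
              * (((d : ℝ) + 1) * (D1 hprof + D2 hprof)) / K * (2 * (((d : ℝ) + 2) * c)) * supN Φ := by
  obtain ⟨c, hc, hL⟩ := eq220_sup_stair F hℓ₁ hLip κ d ℓ hℓ amin aplus m2plus ha
  refine ⟨c, hc, ?_⟩
  intro k hk hn a m2 e1' e2 e3 e4 M hM K j hK2 hKM A₀ A' θ θ' hanti' hθ hA' hθ' hder hbd hsm2 hsm Φ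
  have hK1 : 1 ≤ K := le_trans (by norm_num) hK2
  have hn2 : 2 ≤ (ℓ + 1) ^ k := by
    calc 2 ≤ ℓ + 1 := by omega
      _ = (ℓ + 1) ^ 1 := (pow_one _).symm
      _ ≤ (ℓ + 1) ^ k := Nat.pow_le_pow_right (Nat.succ_pos ℓ) hk
  have hnK : 3 ≤ (ℓ + 1) ^ k * K := by nlinarith
  have hs : 0 ≤ ((d : ℝ) + 1) * (D1 hprof + D2 hprof) := by
    have := D1_nonneg contDiff_hprof hasCompactSupport_hprof
    have := D2_nonneg contDiff_hprof hasCompactSupport_hprof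
    positivity
  have hKr : (1 : ℝ) ≤ K := by exact_mod_cast hK1
  have h0 := hL k hk hn a m2 e1' e2 e3 e4 M hM A₀ A' θ θ' hanti' hθ hA' hθ' hder hbd hsm2 hsm _ _ _ _
    (hsize_hBox hn hK1 hnK hKM j) Φ
  have har := sizes_Minv_field d (1 + ℓ₁ * θ) (B1.aSeq a ((ℓ : ℝ) + 1) k) hKr hs
  have hC0 : 0 ≤ 2 * (((d : ℝ) + 2) * c) := by positivity
  refine h0.trans ?_
  have h1 := mul_le_mul_of_nonneg_right (mul_le_mul_of_nonneg_right har hC0) (supN_nonneg Φ)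
  refine le_trans (le_of_eq ?_) h1
  ring

/-- **«‖K_jG_k(□_j,Ã_j)h_j‖_{q,p} ≤ c₂O(1)M⁻¹» FOR [B4]'s OWN `h_j` AT A REGULAR FIELD ON A BOX, EVERY FACTOR
«‖·‖_{p₁/(i−1),p₁/i}», «‖·‖_{2,2}» OF (2.21) IN THE `η`-WEIGHTED NORMS** (staircase contours; box sides multiples of
`K ≥ 2`; all pairs `1 ≤ p ≤ q < ∞` with `1/p − 1/q ≤ 1/p₁`, `p₁ > d + 1`):
`‖K_{h_j}G_k(□,Ã)(h_jΦ)‖_{q,η} ≤ (2(d+1)(1+ℓθ) + 1 + a_k)·s·K⁻¹·2C·‖Φ‖_{p,η}`, the constant independent of `η`.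
[cite: Balaban1983RegularityDecay, (2.21) p. 578 «c₂O(1)M⁻¹» with p. 575 (h_j), p. 577, p. 579] -/
theorem eq221_hBox_weighted_stair (F : OrthFlow ι) {ℓ₁ : ℝ} (hℓ₁ : 0 ≤ ℓ₁)
    (hLip : ∀ t (v : ι → ℝ), ((F.U t - 1) *ᵥ v) ⬝ᵥ ((F.U t - 1) *ᵥ v) ≤ (ℓ₁ * t) ^ 2 * (v ⬝ᵥ v))
    (κ : ℝ) (d ℓ : ℕ) (hℓ : 1 ≤ ℓ) (amin aplus m2plus : ℝ) (ha : 0 < amin) {p₁ : ℝ} (hp₁ : (d : ℝ) + 1 < p₁) :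
    ∃ c : ℝ, 0 < c ∧ ∃ C : ℝ, 0 < C ∧ ∀ (k : ℕ), 1 ≤ k → ∀ (hn : 1 ≤ (ℓ + 1) ^ k) (a m2 : ℝ),
      amin ≤ a → a ≤ aplus → 0 ≤ m2 → m2 ≤ m2plus →
      ∀ (M : Fin (d + 1) → ℕ), (∀ i, 1 ≤ M i) → ∀ (K : ℕ) (j : Fin (d + 1) → ℤ), 2 ≤ K → (∀ μ, K ∣ M μ) →
      ∀ (A₀ : Fin (d + 1) → ℝ) (A' : ↥(Box d ℓ k M) → ↥(Box d ℓ k M) → ℝ) (θ θ' : ℝ),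
        (∀ x y, A' y x = -A' x y) →
        0 ≤ θ → (∀ x y : ↥(Box d ℓ k M), y.1 ∈ nbrs x.1 → |κ * A' x y| ≤ θ / ((ℓ + 1) ^ k : ℕ)) →
        0 ≤ θ' → (∀ (x z y : ↥(Box d ℓ k M)) (μ : Fin (d + 1)), z.1 = x.1 + e1 μ → y.1 = z.1 + e1 μ →
          |κ * (A' y z - A' z x)| ≤ θ' / (((ℓ + 1) ^ k : ℕ) : ℝ) ^ 2 ∧
          |κ * (A' x z - A' z y)| ≤ θ' / (((ℓ + 1) ^ k : ℕ) : ℝ) ^ 2) →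
        (∀ (x y : ↥(Box d ℓ k M)) (μ : Fin (d + 1)), y.1 = x.1 + e1 μ →
          (x.1 - e1 μ ∉ Box d ℓ k M ∨ y.1 + e1 μ ∉ Box d ℓ k M) → A' x y = 0 ∧ A' y x = 0) →
        ℓ₁ ^ 2 * θ ^ 2 * ((d : ℝ) + 1) * (1 + B1.aSeq a ((ℓ : ℝ) + 1) k * ((d : ℝ) + 1))
          ≤ min 2 (B1.aSeq a ((ℓ : ℝ) + 1) k) / 4 →
        ((d : ℝ) + 2) * c * (((d : ℝ) + 1) * ℓ₁ * (θ + θ') + ((d : ℝ) + 1) * ℓ₁ * θ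
          + ((d : ℝ) + 1) * ℓ₁ ^ 2 * θ ^ 2
          + B1.aSeq a ((ℓ : ℝ) + 1) k * (ℓ₁ * (((d : ℝ) + 1) * θ) * (2 + ℓ₁ * (((d : ℝ) + 1) * θ)))) ≤ 1 / 2 →
        ∀ (p q : ℝ), 1 ≤ p → p ≤ q → p⁻¹ - q⁻¹ ≤ p₁⁻¹ →
        ∀ Φ : ↥(Box d ℓ k M) × ι → ℝ,
          lpW d ℓ k q (kOp F κ ((ℓ + 1) ^ k) (B1.aSeq a ((ℓ : ℝ) + 1) k) m2 M (baseEmb hn M) (stairContour hn M)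
                (constBond A₀ Subtype.val + A') (hBox ((ℓ + 1) ^ k) K M j)
              *ᵥ (greenA d F κ ℓ k a m2 M (baseEmb hn M) (stairContour hn M) (constBond A₀ Subtype.val + A')
                  *ᵥ (mulH (ι := ι) (hBox ((ℓ + 1) ^ k) K M j) *ᵥ Φ)))
            ≤ (2 * ((d : ℝ) + 1) * (1 + ℓ₁ * θ) + 1 + B1.aSeq a ((ℓ : ℝ) + 1) k)
              * (((d : ℝ) + 1) * (D1 hprof + D2 hprof)) / K * (2 * C) * lpW d ℓ k p Φ := by
  obtain ⟨c, hc, C, hC, hL⟩ := eq221_weighted_stair F hℓ₁ hLip κ d ℓ hℓ amin aplus m2plus ha hp₁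
  refine ⟨c, hc, C, hC, ?_⟩
  intro k hk hn a m2 e1' e2 e3 e4 M hM K j hK2 hKM A₀ A' θ θ' hanti' hθ hA' hθ' hder hbd hsm2 hsm p q hp hpq hσ Φ
  have hK1 : 1 ≤ K := le_trans (by norm_num) hK2
  have hn2 : 2 ≤ (ℓ + 1) ^ k := by
    calc 2 ≤ ℓ + 1 := by omega
      _ = (ℓ + 1) ^ 1 := (pow_one _).symm
      _ ≤ (ℓ + 1) ^ k := Nat.pow_le_pow_right (Nat.succ_pos ℓ) hk
  have hnK : 3 ≤ (ℓ + 1) ^ k * K := by nlinarith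
  have hs : 0 ≤ ((d : ℝ) + 1) * (D1 hprof + D2 hprof) := by
    have := D1_nonneg contDiff_hprof hasCompactSupport_hprof
    have := D2_nonneg contDiff_hprof hasCompactSupport_hprof
    positivity
  have hKr : (1 : ℝ) ≤ K := by exact_mod_cast hK1
  have h0 := hL k hk hn a m2 e1' e2 e3 e4 M hM A₀ A' θ θ' hanti' hθ hA' hθ' hder hbd hsm2 hsm p q hp hpq hσ _ _ _ _
    (hsize_hBox hn hK1 hnK hKM j) Φ
  have har := sizes_Minv_field d (1 + ℓ₁ * θ) (B1.aSeq a ((ℓ : ℝ) + 1) k) hKr hs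
  have hC0 : 0 ≤ 2 * C := by positivity
  refine h0.trans ?_
  have h1 := mul_le_mul_of_nonneg_right (mul_le_mul_of_nonneg_right har hC0) (lpW_nonneg d ℓ k p Φ)
  refine le_trans (le_of_eq ?_) h1
  ring

end Concrete

end

end Literature.MathematicalPhysics.QuantumFieldTheory.Balaban1983to89.B4Eq220FactorField
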